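import Summits.ResolutionOfSingularities.ResolutionOfSingularities.Theorems.WildConesCampaignW46HypersurfacesCharTwoIsolTransfer
import Summits.ResolutionOfSingularities.ResolutionOfSingularities.Theorems.WildConesCampaignW46HypersurfacesCharTwoEmbDimMonotone

/-!
# [OURS · L1 W4.6, rung (ii) at p = 2, EVERY dimension n] HOW THE FORCED REGIME IS LEFT when `e ≤ 2`: along
# every branch an isolated double point with `e ≤ 2` reaches, within `μ` blow-ups, either a point of
# multiplicity `< 2` or a NON-isolated double point — and the latter happens exactly after a state with
# `(e, h₂) = (2, 3)` (hypersurface double points `z² = a(u₁,…,uₙ)`, every field of characteristic 2)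

HONEST FRAMING. Everything here is OURS: theorems about route WildCones' own TYPED point-blow-up
dynamics (`Theorems/WildConesClassicalRegimesDefs.lean`: `run c₀ i t m` = the state after `m` blow-ups
along the chart word `i` and translation word `t`; `MultP`, `Isol`, `mu`) with the invariants
`milnorEmbDim = e` (p498937) and `milnorHilbertTwo = h₂` (p511581). Nothing here is a statement of H.
Hironaka's manuscript [Hironaka2017] and nothing of it is used; no FACT-LIST premise. AI review is weaker
than expert review. Cell res-hironaka (LADDER-RESOLUTION rung L, D-0089), slot W4.6, seat res-L1-s46-pv-4
(gen 4); host route `WildCones`, crux `ClassicalRegimes` (stmt-ResolutionOfSingularities-16884, proved);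
`--supports … --as helper`.

WHAT IS HERE — consequences of the complete one-step criterion (`hypersurface_isol_step_iff`, p514670),
the monotonicity `e(successor) ≤ e(c)` (p515087) and the crux's effective exit (`exists_exit_le_mu`,
p467896) for runs starting at an isolated double point with `e ≤ 2` (polar corank `≤ 2`; this covers every
order-2-cleaned double point of a threefold or fourfold, `n ≤ 4`):
* `hypersurface_not_isol_step_iff` — one step: the double successor is NON-isolated iff `(e, h₂) = (2, 3)`.
* `hypersurface_isol_run_iff` — along a prefix of double points: all states isolated iff no earlier state
  has `(e, h₂) = (2, 3)`.
* `hypersurface_exit_classification` — THE EXIT: along every chart/translation word there is an index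
  `m ≤ μ(c₀)` with all earlier states isolated double points and state `m` EITHER of multiplicity `< 2`
  (the branch is resolved there) OR a non-isolated double point, in which case `m ≥ 1` and state `m - 1`
  has `(e, h₂) = (2, 3)` — the forced (isolated) regime is left sideways ONLY through a
  «no-tangent-cubic» state.

References: G.-M. Greuel, G. Pfister [GreuelPfister2026] (context); H. Hironaka, ms. 2017-03-23
[Hironaka2017] — ROLE only (Th. 16.6 p.84, §16.3 / Th. 16.13 p.87: the renewal of the procedure's
hypotheses and its termination), under adjudication, never as fact.
-/

noncomputable section

-- single-problem summit: the doubled namespace component `ResolutionOfSingularities` is forced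
set_option linter.dupNamespace false

open scoped BigOperators Classical

open MvPowerSeries IsLocalRing

open Literature.AlgebraicGeometry.Resolution

namespace Summit.ResolutionOfSingularities.ResolutionOfSingularities.Theorems

namespace CampaignW46.HypersurfacesCharTwo

open WildCones WildCones.MuDropCharTwoOrdP ThreefoldsCharTwo

variable {κ : Type} [Field κ] {n : ℕ}

/-- [OURS · L1 W4.6 rung (ii) at `p = 2`, every dimension; NOT a statement of the manuscript] **ONE STEP,
`e ≤ 2`: the double successor of an isolated double state is NON-isolated iff `(e, h₂) = (2, 3)`**
(no tangent cubic in the residual plane). [folklore] -/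
theorem hypersurface_not_isol_step_iff [CharP κ 2] (c : (Fin n → ℕ) → κ) (i : Fin n) (τ : Fin n → κ)
    (hM : MultP 2 n κ c) (hI : Isol 2 n κ c) (he : milnorEmbDim 2 n κ c ≤ 2)
    (hM' : MultP 2 n κ (step 2 n κ i τ c)) :
    ¬ Isol 2 n κ (step 2 n κ i τ c) ↔ milnorEmbDim 2 n κ c = 2 ∧ milnorHilbertTwo 2 n κ c = 3 := by
  rw [hypersurface_isol_step_iff c i τ hM hI hM']
  constructor
  · intro h
    have he2 : milnorEmbDim 2 n κ c = 2 := by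
      by_contra hne
      exact h (Or.inl (by omega))
    have hr := milnorHilbertTwo_range hM he2
    have h3 : ¬ milnorHilbertTwo 2 n κ c ≤ 2 := fun hh => h (Or.inr ⟨he2, hh⟩)
    exact ⟨he2, by omega⟩
  · rintro ⟨he2, hh3⟩ (h | ⟨-, hh⟩) <;> omega

/-- [OURS · L1 W4.6 rung (ii) at `p = 2`, every dimension; NOT a statement of the manuscript] **ALONG A
PREFIX OF DOUBLE POINTS**: from an isolated double state `c₀` with `e(c₀) ≤ 2`, if the states `0, …, M`
of a run are double points, then they are ALL isolated iff none of the states `0, …, M - 1` has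
`(e, h₂) = (2, 3)`. (Monotonicity keeps `e ≤ 2` along the prefix.) [folklore] -/
theorem hypersurface_isol_run_iff [CharP κ 2] (c₀ : (Fin n → ℕ) → κ) (i : ℕ → Fin n)
    (t : ℕ → Fin n → κ) (hI₀ : Isol 2 n κ c₀) (he₀ : milnorEmbDim 2 n κ c₀ ≤ 2) :
    ∀ M : ℕ, (∀ m ≤ M, MultP 2 n κ (run 2 n κ c₀ i t m)) →
      ((∀ m ≤ M, Isol 2 n κ (run 2 n κ c₀ i t m)) ↔
        ∀ m < M, ¬ (milnorEmbDim 2 n κ (run 2 n κ c₀ i t m) = 2 ∧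
          milnorHilbertTwo 2 n κ (run 2 n κ c₀ i t m) = 3)) := by
  intro M
  induction M with
  | zero =>
    intro _
    constructor
    · intro _ m hm; omega
    · intro _ m hm
      have : m = 0 := by omega
      subst this
      exact hI₀
  | succ M ih =>
    intro hrun
    have hrunM : ∀ m ≤ M, MultP 2 n κ (run 2 n κ c₀ i t m) := fun m hm => hrun m (by omega)
    have ihM := ih hrunM
    have heM : milnorEmbDim 2 n κ (run 2 n κ c₀ i t M) ≤ 2 :=
      (hypersurface_milnorEmbDim_run_le c₀ i t hrunM M le_rfl).trans he₀
    constructor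
    · intro hall m hm
      have hallM : ∀ k ≤ M, Isol 2 n κ (run 2 n κ c₀ i t k) := fun k hk => hall k (by omega)
      rcases Nat.lt_or_ge m M with hlt | hge
      · exact ihM.mp hallM m hlt
      · have hmM : m = M := by omega
        subst hmM
        intro hbad
        have hstep := (hypersurface_not_isol_step_iff (run 2 n κ c₀ i t m) (i m) (t m)
          (hrunM m le_rfl) (hallM m le_rfl) heM (hrun (m + 1) le_rfl)).mpr hbad
        exact hstep (hall (m + 1) le_rfl)
    · intro hno m hm
      have hnoM : ∀ k < M, ¬ (milnorEmbDim 2 n κ (run 2 n κ c₀ i t k) = 2 ∧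
          milnorHilbertTwo 2 n κ (run 2 n κ c₀ i t k) = 3) := fun k hk => hno k (by omega)
      have hallM := ihM.mpr hnoM
      rcases Nat.lt_or_ge m (M + 1) with hlt | hge
      · exact hallM m (by omega)
      · have hmM : m = M + 1 := by omega
        subst hmM
        by_contra hnot
        exact hno M (by omega) ((hypersurface_not_isol_step_iff (run 2 n κ c₀ i t M) (i M) (t M)
          (hrunM M le_rfl) (hallM M le_rfl) heM (hrun (M + 1) le_rfl)).mp hnot)

/-- [OURS · L1 W4.6 rung (ii) at `p = 2`, every dimension; NOT a statement of the manuscript] **HOW THE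
FORCED REGIME IS LEFT (`e ≤ 2`)** (hypersurface double points `z² = a(u₁,…,uₙ)`, any field of
characteristic `2`, any `n`): from an isolated double state `c₀` with `e(c₀) ≤ 2`, along EVERY chart word
and translation word there is an index `m ≤ μ(c₀)` such that the states before `m` are isolated double
points and the state `m` is EITHER of multiplicity `< 2` (the branch has left the double locus — for a
resolved chart this is smoothness) OR a NON-isolated double point; in the second case `m ≥ 1` and the
state `m - 1` has `(e, h₂) = (2, 3)` — sideways exits happen only through «no tangent cubic» states.
[folklore] -/
theorem hypersurface_exit_classification [CharP κ 2] (c₀ : (Fin n → ℕ) → κ) (i : ℕ → Fin n)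
    (t : ℕ → Fin n → κ) (hI₀ : Isol 2 n κ c₀) (he₀ : milnorEmbDim 2 n κ c₀ ≤ 2) :
    ∃ m ≤ mu 2 n κ c₀,
      (∀ k < m, MultP 2 n κ (run 2 n κ c₀ i t k) ∧ Isol 2 n κ (run 2 n κ c₀ i t k)) ∧
      (¬ MultP 2 n κ (run 2 n κ c₀ i t m) ∨
        (MultP 2 n κ (run 2 n κ c₀ i t m) ∧ ¬ Isol 2 n κ (run 2 n κ c₀ i t m) ∧ 1 ≤ m ∧
          milnorEmbDim 2 n κ (run 2 n κ c₀ i t (m - 1)) = 2 ∧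
          milnorHilbertTwo 2 n κ (run 2 n κ c₀ i t (m - 1)) = 3)) := by
  classical
  obtain ⟨m₀, hm₀, hexit⟩ := exists_exit_le_mu c₀ i t
  have hex : ∃ m, ¬ (Isol 2 n κ (run 2 n κ c₀ i t m) ∧ MultP 2 n κ (run 2 n κ c₀ i t m)) := ⟨m₀, hexit⟩
  let m := Nat.find hex
  have hm : ¬ (Isol 2 n κ (run 2 n κ c₀ i t m) ∧ MultP 2 n κ (run 2 n κ c₀ i t m)) := Nat.find_spec hex
  have hle : m ≤ m₀ := Nat.find_min' hex hexit
  have hbefore : ∀ k < m, MultP 2 n κ (run 2 n κ c₀ i t k) ∧ Isol 2 n κ (run 2 n κ c₀ i t k) :=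
    fun k hk => by
      have := Nat.find_min hex hk
      push Not at this
      exact ⟨this.2, this.1⟩
  refine ⟨m, hle.trans hm₀, hbefore, ?_⟩
  by_cases hMm : MultP 2 n κ (run 2 n κ c₀ i t m)
  · right
    have hIm : ¬ Isol 2 n κ (run 2 n κ c₀ i t m) := fun h => hm ⟨h, hMm⟩
    have hm1 : 1 ≤ m := by
      by_contra h0
      have : m = 0 := by omega
      rw [this] at hIm
      exact hIm hI₀
    refine ⟨hMm, hIm, hm1, ?_⟩
    -- the state `m - 1` is an isolated double point with `e ≤ 2`, its successor is `run m`
    have hrun : ∀ k ≤ m - 1, MultP 2 n κ (run 2 n κ c₀ i t k) := fun k hk => (hbefore k (by omega)).1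
    have heM : milnorEmbDim 2 n κ (run 2 n κ c₀ i t (m - 1)) ≤ 2 :=
      (hypersurface_milnorEmbDim_run_le c₀ i t hrun (m - 1) le_rfl).trans he₀
    have hs : run 2 n κ c₀ i t m = step 2 n κ (i (m - 1)) (t (m - 1)) (run 2 n κ c₀ i t (m - 1)) := by
      obtain ⟨k, hk⟩ : ∃ k, m = k + 1 := ⟨m - 1, by omega⟩
      rw [hk]
      rfl
    rw [hs] at hMm hIm
    exact (hypersurface_not_isol_step_iff (run 2 n κ c₀ i t (m - 1)) (i (m - 1)) (t (m - 1))
      (hbefore (m - 1) (by omega)).1 (hbefore (m - 1) (by omega)).2 heM hMm).mp hIm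
  · exact Or.inl hMm

end CampaignW46.HypersurfacesCharTwo

end Summit.ResolutionOfSingularities.ResolutionOfSingularities.Theorems

end
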